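import Summits.CriticalPhenomena.PercolationContinuityZ3.Theorems.PercNearOneGluingNoHeavyLowerTailIncStarIrreducible
import Summits.CriticalPhenomena.PercolationContinuityZ3.Theorems.PercNearOneGluingNoHeavyLowerTailFrontierIncRowsLeFive
import HarnessLib

/-!
# The increasing star reduces to irreducible marked graphs with at least six vertices (computational companion)

Support file for the Sahi programme (`--supports stmt-CriticalPhenomena-4575`, prover prim-sahi-p2 gen 12).  COMPUTATIONAL: it combines the
kernel reduction theorem `IncStarIrreducible.incStar_of_irreducible` (standard axioms) with prim-bnk-1's five-vertex theorem
`FrontierIncRows.incStar_le_five`, which rests on `native_decide` comb certificates — so the theorem below inherits those `native_decide` axioms and is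
to be cited as CERTIFIED, never as kernel.  No definitions, no named facts, no sorries.  Memo `…/prim-sahi-p2/PROOF-E3.md` §23l.

* `incStar_of_irreducible_six`: if the increasing star `0 ≤ E₃({s↔a},{s↔b},{s↔c})` holds for every IRREDUCIBLE marked weighted graph on `Fin n` with
  `6 ≤ n` (clauses as in `…IncStarIrreducible`: pairwise distinct marks, loop-free, 2-connected, unmarked degree ≥ 3, no blob, no targetless root side),
  then it holds on every finite weighted graph.  (The exact K₇ fibre certificate of the programme would raise `6` to `8`; it is not a Lean theorem.)
-/

noncomputable section

namespace Summit.CriticalPhenomena.PercolationContinuityZ3.Theorems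

namespace IncStarIrreducible

open Finset MeasureTheory Literature.Combinatorics.Sahi2008 Literature.Probability.Percolation
  Literature.Probability.LatticeModels
open scoped Classical

/-- **Reduction to irreducible marked graphs with at least six vertices** (certified: inherits the `native_decide` axioms of
`FrontierIncRows.incStar_le_five` for the graphs on at most five vertices). [this work] -/
theorem incStar_of_irreducible_six
    (H : ∀ (n : ℕ) (w : Sym2 (Fin n) → unitInterval) (s a b c : Fin n), 6 ≤ n →
      s ≠ a → s ≠ b → s ≠ c → a ≠ b → a ≠ c → b ≠ c →
      (∀ x : Fin n, w s(x, x) = 0) →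
      (∀ (V₁ V₂ : Finset (Fin n)) (x : Fin n), (∀ y, y ∈ V₁ → y ∈ V₂ → y = x) → x ∈ V₁ → x ∈ V₂ → s ∈ V₁ →
          (∀ y, y ∈ V₁ ∨ y ∈ V₂) → (∀ y z, y ∈ V₁ → z ∈ V₂ → y ≠ x → z ≠ x → w s(y, z) = 0) →
          (∀ y ∈ V₁, y = x) ∨ (∀ z ∈ V₂, z = x)) →
      (∀ x y y' : Fin n, x ≠ s → x ≠ a → x ≠ b → x ≠ c → x ≠ y → x ≠ y' → y ≠ y' →
          ∃ z, z ≠ y ∧ z ≠ y' ∧ w s(x, z) ≠ 0) →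
      (∀ (B : Finset (Fin n)) (u v : Fin n), B.Nonempty → u ∉ B → v ∉ B → u ≠ v → s ∉ B → a ∉ B → b ∉ B → c ∉ B →
          ∃ x ∈ B, ∃ z, z ∉ B ∧ z ≠ u ∧ z ≠ v ∧ w s(x, z) ≠ 0) →
      (∀ (R : Finset (Fin n)) (h u v : Fin n), s ∈ R → h ∈ R → h ≠ s → u ∉ R → v ∉ R → u ≠ v → a ∉ R → b ∉ R →
          c ∉ R → ∃ x ∈ R, ∃ z, z ∉ R ∧ z ≠ u ∧ z ≠ v ∧ w s(x, z) ≠ 0) →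
      0 ≤ sahiE3 (prodBernoulli w) (openConn s a) (openConn s b) (openConn s c))
    {V : Type*} [Fintype V] (w : Sym2 V → unitInterval) (s a b c : V) :
    0 ≤ sahiE3 (prodBernoulli w) (openConn s a) (openConn s b) (openConn s c) := by
  refine incStar_of_irreducible (fun n w s a b c hsa hsb hsc hab hac hbc h0 h1 h2 h3 h4 => ?_) w s a b c
  rcases Nat.lt_or_ge n 6 with hn | hn
  · exact FrontierIncRows.incStar_le_five (by omega) w s a b c hsa hsb hsc hab hac hbc
  · exact H n w s a b c hn hsa hsb hsc hab hac hbc h0 h1 h2 h3 h4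

end IncStarIrreducible

end Summit.CriticalPhenomena.PercolationContinuityZ3.Theorems
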